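import Literature.Topology.FourManifolds.SliceDiscConicalFramingPrelim
import Literature.Topology.FourManifolds.SliceDiscEndCollarFacts
import HarnessLib

/-!
# The conical transversal framing of a conical slice disc, and the framed conical tube

Topic `Literature/Topology/FourManifolds`. This file **discharges** the named fact
`Literature.Topology.FourManifolds.Knot.IsSliceDisc.exists_conicalTube_hasFraming_zero`
(`SliceDiscEndCollarFacts.lean`; `…_holds` below): a slice disc `g` of the knot `K` which is the cone
`g (t • u) = t • K u` on the band `1 - s₁ ≤ t ≤ 1` has a trivialised tubular neighbourhood
`G : D̊² × B(0, 2) ↪ B̊⁴` of its interior, conical over an oriented tubular neighbourhood `ν` of `K` of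
framing `0` on the band, deep where the disc is deep — the *neat tubular neighbourhood* of a neat
submanifold (Kosinski, *Differential Manifolds* (1993), Ch. III (4.1)–(4.2)) with Kirby's description
of the zero framing (*The Topology of 4-Manifolds* (1989), Ch. I §2, p. 6). It is the open leaf (V) of
the construction step of Manolescu–Piccirillo (2023), Lemma 3.3 for `W = S⁴`
(`ZeroSurgeryHomotopyBallSliceConstruction.lean`, `SliceDiscEndCollar.lean`).

By `SliceDiscConicalTube.lean` (the tube from a conical transversal framing) and
`SliceDiscConicalTubeFraming.lean` (its framing is `0`) it remains to produce a `ConicalFraming K` with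
the prescribed disc `g` and band width `s₁`: two `C^∞` vector fields `n₀, n₁` along the open disc,
transversal to it, which on a band `1 - s₂ < ‖x‖ < 1`, `s₂ > s₁`, are the cone
`nᵢ (t • u) = t • D_w|₀ ν(u, ·) eᵢ` on the fibre derivative of some oriented tubular neighbourhood `ν`
of `K`. The construction (`Knot.IsSliceDisc.exists_conicalFraming`):

1. **Normal frame of the disc** (`NormalFrameTransport.lean`): a `C^∞` frame `F₀, F₁` of the normal
   bundle of `g` on a ball `B(0, R')`, `R' > 1`. Along a conical ray the tangent plane is constant
   (`fderiv_eq_fderiv_coneSec_of_cone`), so `Nᵢ(u) = Fᵢ(r₀ u)` (`r₀ = 1 - s₁/2`) is a normal frame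
   all along the ray `t • u`, `1 - s₁ ≤ t < 1`.
2. **Reframing the knot tube** (`TubularNbhdReframe.lean`): for a tubular neighbourhood `ν₀` of `K`,
   the normal projections `Bⱼ(u)` of its fibre derivatives `fⱼ(u) = D_w|₀ ν₀(u, ·) eⱼ` form another
   frame of the same normal plane (the cone tube is an immersion); the change of frame
   `Nᵢ(u) = ∑ⱼ Mⱼᵢ(u) Bⱼ(u)` is a smooth loop of invertible matrices (`frameCoeff`), of positive
   determinant after replacing `F₁` by `-F₁` if necessary (the sign is constant on the circle), and
   `ν = ν₀.reframe M` has fibre derivatives `cᵢ(u) = ∑ⱼ Mⱼᵢ(u) fⱼ(u)` whose normal projections are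
   exactly `Nᵢ(u)`.
3. **The deep frame** `nᵢ(x) = P(x) Fᵢ(ρ x)`, `P(x)` the normal projection at `x` and `ρ` the radial
   push onto the circle of radius `r₀` (identity below `α`, completed below `1 - s₁`), equals `Nᵢ(u)`
   on the band and is transversal everywhere: below the band by openness of transversality near the
   compact inner edge (`exists_thickening_linearIndependent`), which fixes `α`.
4. **The blend** `n'ᵢ = (1 - φ) nᵢ + φ cxᵢ` into the cone `cxᵢ(t • u) = t • cᵢ(u)` with a radial
   cut-off `φ` supported just below `1 - s₁`: on the inner edge `P (n'ᵢ) = ((1 - φ) + φ t) Nᵢ(u)` is a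
   frame for every value of the cut-off, so again by openness the blend is transversal on a thin zone
   below the edge, which fixes `φ` and `s₂ = s₁ + (width)/2`.

## Main statements

* `Knot.IsSliceDisc.exists_conicalFraming`: the `ConicalFraming` datum with prescribed `g`, `s₁`.
* `Knot.IsSliceDisc.exists_conicalTube_hasFraming_zero_holds`: **the named fact, proved.**

## References

* A. A. Kosinski, *Differential Manifolds* (1993), Ch. III (4.1)–(4.2). [cite: Kosinski1993, Ch. III Thm (4.2)]
* R. C. Kirby, *The Topology of 4-Manifolds*, LNM 1374 (1989), Ch. I §2, p. 6. [cite: Kirby1989, Ch. I §2]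
* M. W. Hirsch, *Differential Topology*, GTM 33 (1976), Ch. 4 §2 Cor. 2.5, §5 Thm. 5.1. [cite: HirschDT1976, Ch. 4 §5 Thm. 5.1]
* C. Manolescu, L. Piccirillo, J. London Math. Soc. 108 (2023), §3.2, proof of Lemma 3.3.
  [cite: ManolescuPiccirillo2023, §3.2, proof of Lemma 3.3]

## Mathlib / tree search

`unitVec` (the coercion to `ℝ²` of the tree's `radialProjection (spherePt 1)`, the map through which
`Knot.TubularNbhd.coneTube` is defined — so that `unitVec (t • u) = u` is `radialProjection_smul`) has a
namesake `Literature.Topology.FourManifolds.BlowDownFlat.unitVec` in `BlowDownFlatModel.lean` with a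
different junk value at the origin and an unrelated import chain (Kirby moves); it is not reused. The
staging structures `FramingSetup…` are new (`lean search`).

## Design notes

* The construction is staged through the structures `FramingSetup ⊆ FramingSetup₂ ⊆ FramingSetup₃ ⊆
  FramingSetup₄` (parametrised by `K`, `g`, `s₁`), each adding the parameters fixed at that stage;
  the existence statements `nonempty_…` make the choices.
* No named facts, no `sorry`; local notation and the two local `Fact`s as in the sibling files.
-/

noncomputable section

open Set Metric Function Filter
open scoped Manifold ContDiff Topology RealInnerProductSpace

namespace Literature.Topology.FourManifolds

/-- Local notation: `𝔼 n` is the model Euclidean space `EuclideanSpace ℝ (Fin n)`. -/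
local notation "𝔼 " n:arg => EuclideanSpace ℝ (Fin n)

/-- Local notation: `𝕊 n` is the unit sphere in `EuclideanSpace ℝ (Fin (n + 1))`. -/
local notation "𝕊 " n:arg => (Metric.sphere (0 : EuclideanSpace ℝ (Fin (n + 1))) 1)

attribute [local instance] fact_finrank_euclideanSpace_two fact_finrank_euclideanSpace_four

/-! ### The unit vector field -/

/-- The unit vector `x/‖x‖` (junk on `x = 0`), through the tree's `radialProjection`. [folklore] -/
def unitVec (x : 𝔼 2) : 𝔼 2 := ((radialProjection (spherePt 1) x : 𝕊 1) : 𝔼 2)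

/-- Off the origin `unitVec x = ‖x‖⁻¹ • x`. [folklore] -/
theorem unitVec_eq {x : 𝔼 2} (hx : x ≠ 0) : unitVec x = ‖x‖⁻¹ • x :=
  coe_radialProjection_of_ne_zero _ hx

/-- `‖x‖ • unitVec x = x`. [folklore] -/
theorem norm_smul_unitVec (x : 𝔼 2) : ‖x‖ • unitVec x = x := norm_smul_coe_radialProjection _ x

/-- `unitVec (t • u) = u` for `t > 0`, `u ∈ 𝕊¹`. [folklore] -/
theorem unitVec_smul_coe {t : ℝ} (ht : 0 < t) (u : 𝕊 1) : unitVec (t • (u : 𝔼 2)) = u := by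
  rw [unitVec, radialProjection_smul _ ht]

/-- `unitVec u = u` for `u ∈ 𝕊¹`. [folklore] -/
@[simp] theorem unitVec_coe (u : 𝕊 1) : unitVec (u : 𝔼 2) = u := by
  rw [unitVec, radialProjection_coe_sphere]

/-- The unit vector has norm `1` off the origin. [folklore] -/
theorem norm_unitVec {x : 𝔼 2} (hx : x ≠ 0) : ‖unitVec x‖ = 1 := by
  rw [unitVec_eq hx, norm_smul, norm_inv, norm_norm, inv_mul_cancel₀ (norm_ne_zero_iff.2 hx)]

/-- The unit vector field is `C^∞` off the origin. [folklore] -/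
theorem contDiffAt_unitVec {x : 𝔼 2} (hx : x ≠ 0) : ContDiffAt ℝ ∞ unitVec x := by
  have hev : unitVec =ᶠ[𝓝 x] fun y : 𝔼 2 ↦ ‖y‖⁻¹ • y :=
    Filter.eventuallyEq_of_mem (isOpen_ne.mem_nhds hx) fun y hy ↦ unitVec_eq hy
  exact (((contDiffAt_norm ℝ hx).inv (norm_ne_zero_iff.2 hx)).smul contDiffAt_id).congr_of_eventuallyEq hev

/-- `x = ‖x‖ • u` with `u = radialProjection x ∈ 𝕊¹`. [folklore] -/
theorem eq_norm_smul_radialProjection (x : 𝔼 2) :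
    x = ‖x‖ • ((radialProjection (spherePt 1) x : 𝕊 1) : 𝔼 2) := (norm_smul_coe_radialProjection _ x).symm

namespace Knot

/-! ### Stage 1: the disc, its normal frame, a tube of the knot -/

/-- **Stage 1 of the construction.** The conical slice disc `g` (band width `s₁`), a `C^∞` normal frame
`F₀, F₁` of `g` on a ball `B(0, R')`, `R' > 1` (from `exists_normalFrame`), and an oriented tubular
neighbourhood `ν₀` of the knot. [folklore] -/
structure FramingSetup (K : Knot) (g : 𝔼 2 → 𝔼 4) (s₁ : ℝ) where
  /-- radius of the ball carrying the normal frame -/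
  R' : ℝ
  /-- the normal frame of the disc -/
  F : Fin 2 → 𝔼 2 → 𝔼 4
  /-- a tubular neighbourhood of the knot -/
  ν₀ : Knot.TubularNbhd K
  isSliceDisc : K.IsSliceDisc g
  s₁_pos : 0 < s₁
  s₁_lt_one : s₁ < 1
  g_cone : ∀ (u : 𝕊 1) (t : ℝ), 1 - s₁ ≤ t → t ≤ 1 → g (t • (u : 𝔼 2)) = t • ((K u : 𝕊 3) : 𝔼 4)
  one_lt_R' : 1 < R'
  injective_fderiv : ∀ x ∈ ball (0 : 𝔼 2) R', Injective (fderiv ℝ g x)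
  contDiffOn_F : ∀ i, ContDiffOn ℝ ∞ (F i) (ball (0 : 𝔼 2) R')
  normProj_F : ∀ x ∈ ball (0 : 𝔼 2) R', ∀ i, normProjField g x (F i x) = F i x
  linearIndependent_F : ∀ x ∈ ball (0 : 𝔼 2) R', LinearIndependent ℝ (fun i ↦ F i x)

/-- **Stage 1 exists** for every conical slice disc. [folklore] -/
theorem nonempty_framingSetup {K : Knot} {g : 𝔼 2 → 𝔼 4} {s₁ : ℝ} (hg : K.IsSliceDisc g) (hs₁ : 0 < s₁)
    (hs₁' : s₁ < 1)
    (hcone : ∀ (u : 𝕊 1) (t : ℝ), 1 - s₁ ≤ t → t ≤ 1 → g (t • (u : 𝔼 2)) = t • ((K u : 𝕊 3) : 𝔼 4)) :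
    Nonempty (FramingSetup K g s₁) := by
  obtain ⟨R', F, hR', hinj, hF, hFn, hFi⟩ := exists_normalFrame hg.1 finrank_euclideanSpace_fin one_pos
    hg.2.2.1
  obtain ⟨ν₀⟩ := Knot.nonempty_tubularNbhd_holds K
  exact ⟨⟨R', F, ν₀, hg, hs₁, hs₁', hcone, hR', hinj, hF, hFn, hFi⟩⟩

namespace FramingSetup

variable {K : Knot} {g : 𝔼 2 → 𝔼 4} {s₁ : ℝ} (S : FramingSetup K g s₁)

/-! #### Radii -/

/-- The inner edge `t₀ = 1 - s₁` of the conical band (the setup only pins the implicit `s₁`).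
[folklore] -/
def t₀ (_S : FramingSetup K g s₁) : ℝ := 1 - s₁

/-- The reference radius `r₀ = 1 - s₁/2` inside the conical band. [folklore] -/
def r₀ (_S : FramingSetup K g s₁) : ℝ := 1 - s₁ / 2

/-- Unfolding of `t₀`. [folklore] -/
theorem t₀_def : S.t₀ = 1 - s₁ := rfl

/-- Unfolding of `r₀`. [folklore] -/
theorem r₀_def : S.r₀ = 1 - s₁ / 2 := rfl

/-- `0 < t₀`. [folklore] -/
theorem t₀_pos : 0 < S.t₀ := by unfold t₀; linarith [S.s₁_lt_one]

/-- `t₀ < r₀`. [folklore] -/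
theorem t₀_lt_r₀ : S.t₀ < S.r₀ := by unfold t₀ r₀; linarith [S.s₁_pos]

/-- `r₀ < 1`. [folklore] -/
theorem r₀_lt_one : S.r₀ < 1 := by unfold r₀; linarith [S.s₁_pos]

/-- `0 < r₀`. [folklore] -/
theorem r₀_pos : 0 < S.r₀ := S.t₀_pos.trans S.t₀_lt_r₀

/-- `t₀ < 1`. [folklore] -/
theorem t₀_lt_one : S.t₀ < 1 := S.t₀_lt_r₀.trans S.r₀_lt_one

/-- `r₀ < R'`. [folklore] -/
theorem r₀_lt_R' : S.r₀ < S.R' := S.r₀_lt_one.trans S.one_lt_R'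

include S in
/-- The disc is `C^∞`. [folklore] -/
theorem contDiff_g : ContDiff ℝ ∞ g := S.isSliceDisc.1

/-- The unit ball lies in the frame ball. [folklore] -/
theorem ball_subset : ball (0 : 𝔼 2) 1 ⊆ ball (0 : 𝔼 2) S.R' := ball_subset_ball S.one_lt_R'.le

/-- `s • u ∈ B(0, R')` for `|s| < R'`. [folklore] -/
theorem smul_coe_mem_ball {s : ℝ} (hs : |s| < S.R') (u : 𝕊 1) : s • (u : 𝔼 2) ∈ ball (0 : 𝔼 2) S.R' := by
  rw [mem_ball_zero_iff, norm_smul, norm_eq_of_mem_sphere u, mul_one, Real.norm_eq_abs]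
  exact hs

/-- `r₀ • u ∈ B(0, R')`. [folklore] -/
theorem r₀_smul_mem_ball (u : 𝕊 1) : S.r₀ • (u : 𝔼 2) ∈ ball (0 : 𝔼 2) S.R' :=
  S.smul_coe_mem_ball (by rw [abs_of_pos S.r₀_pos]; exact S.r₀_lt_R') u

/-! #### The normal projection field and the conical rays -/

/-- The normal projection at `x` (the setup only pins the implicit `g`). [folklore] -/
def P (_S : FramingSetup K g s₁) (x : 𝔼 2) : 𝔼 4 →L[ℝ] 𝔼 4 := normProjField g x

/-- Unfolding of `P`. [folklore] -/
theorem P_apply (x : 𝔼 2) : S.P x = normProj (fderiv ℝ g x) := rfl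

/-- `P` is `C^∞` at every point of the frame ball. [folklore] -/
theorem contDiffAt_P {x : 𝔼 2} (hx : x ∈ ball (0 : 𝔼 2) S.R') : ContDiffAt ℝ ∞ S.P x :=
  contDiffAt_normProjField S.contDiff_g (S.injective_fderiv x hx)

/-- **Along a conical ray the derivative of the disc is that of the cone**: for `t₀ ≤ t < 1`,
`Dg(t • u) = D(coneSec ν₀)(u)`. [folklore] -/
theorem fderiv_g_ray (u : 𝕊 1) {t : ℝ} (ht : S.t₀ ≤ t) (ht' : t < 1) :
    fderiv ℝ g (t • (u : 𝔼 2)) = fderiv ℝ S.ν₀.coneSec (u : 𝔼 2) :=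
  S.ν₀.fderiv_eq_fderiv_coneSec_of_cone S.contDiff_g S.s₁_pos S.s₁_lt_one S.g_cone u ht ht'

/-- In particular `Dg(t • u) = Dg(r₀ • u)` for `t₀ ≤ t < 1`. [folklore] -/
theorem fderiv_g_ray_eq (u : 𝕊 1) {t : ℝ} (ht : S.t₀ ≤ t) (ht' : t < 1) :
    fderiv ℝ g (t • (u : 𝔼 2)) = fderiv ℝ g (S.r₀ • (u : 𝔼 2)) := by
  rw [S.fderiv_g_ray u ht ht', S.fderiv_g_ray u S.t₀_lt_r₀.le S.r₀_lt_one]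

/-- `P (t • u) = P (r₀ • u)` for `t₀ ≤ t < 1`. [folklore] -/
theorem P_ray (u : 𝕊 1) {t : ℝ} (ht : S.t₀ ≤ t) (ht' : t < 1) :
    S.P (t • (u : 𝔼 2)) = S.P (S.r₀ • (u : 𝔼 2)) := by
  rw [P_apply, P_apply, S.fderiv_g_ray_eq u ht ht']

/-- The derivative `Dg(r₀ • u)` is injective. [folklore] -/
theorem injective_fderiv_r₀ (u : 𝕊 1) : Injective (fderiv ℝ g (S.r₀ • (u : 𝔼 2))) :=
  S.injective_fderiv _ (S.r₀_smul_mem_ball u)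

/-! #### The boundary frame `Nᵢ` and the projected fibre frame `Bⱼ` -/

/-- **The boundary frame** `Nᵢ x = Fᵢ (r₀ • x/‖x‖)` (used at `x = u ∈ 𝕊¹`). [folklore] -/
def N (i : Fin 2) (x : 𝔼 2) : 𝔼 4 := S.F i (S.r₀ • unitVec x)

/-- On the circle `Nᵢ u = Fᵢ (r₀ • u)`. [folklore] -/
theorem N_coe (i : Fin 2) (u : 𝕊 1) : S.N i u = S.F i (S.r₀ • (u : 𝔼 2)) := by
  rw [N, unitVec_coe]

/-- The boundary frame is `C^∞` off the origin. [folklore] -/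
theorem contDiffAt_N (i : Fin 2) {x : 𝔼 2} (hx : x ≠ 0) : ContDiffAt ℝ ∞ (S.N i) x := by
  have hmem : S.r₀ • unitVec x ∈ ball (0 : 𝔼 2) S.R' := by
    rw [mem_ball_zero_iff, norm_smul, norm_unitVec hx, mul_one, Real.norm_of_nonneg S.r₀_pos.le]
    exact S.r₀_lt_R'
  exact ((S.contDiffOn_F i).contDiffAt (isOpen_ball.mem_nhds hmem)).comp x
    ((contDiffAt_unitVec hx).const_smul S.r₀)

/-- The boundary frame is normal at `r₀ • u`: `P (r₀ u) (Nᵢ u) = Nᵢ u`. [folklore] -/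
theorem P_N (i : Fin 2) (u : 𝕊 1) : S.P (S.r₀ • (u : 𝔼 2)) (S.N i u) = S.N i u := by
  rw [N_coe]
  exact S.normProj_F _ (S.r₀_smul_mem_ball u) i

/-- The boundary frame is linearly independent. [folklore] -/
theorem linearIndependent_N (u : 𝕊 1) : LinearIndependent ℝ (fun i ↦ S.N i u) := by
  simp only [N_coe]
  exact S.linearIndependent_F _ (S.r₀_smul_mem_ball u)

/-- **The fibre derivatives of the cone tube of `ν₀`** along the zero section:
`fⱼ x = D(coneTube)(x, 0) (0, eⱼ)` (at `x = u ∈ 𝕊¹` this is `D_w|₀ ν₀(u, ·) eⱼ`). [folklore] -/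
def f (j : Fin 2) (x : 𝔼 2) : 𝔼 4 := fderiv ℝ S.ν₀.coneTube (x, 0) (0, EuclideanSpace.single j 1)

/-- Off the origin `fⱼ x` is the fibre derivative `D_w|₀ coneTube (x, ·) eⱼ`. [folklore] -/
theorem f_eq_fderiv_fibre (j : Fin 2) {x : 𝔼 2} (hx : x ≠ 0) :
    S.f j x = fderiv ℝ (fun w : 𝔼 2 ↦ S.ν₀.coneTube (x, w)) 0 (EuclideanSpace.single j 1) := by
  rw [f, fderiv_comp_prodMk_right S.ν₀.coneTube
    ((S.ν₀.contDiffAt_coneTube (q := (x, 0)) hx).differentiableAt (by simp))]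

/-- On the circle `fⱼ u = D_w|₀ ν₀(u, ·) eⱼ`. [folklore] -/
theorem f_coe (j : Fin 2) (u : 𝕊 1) :
    S.f j u = fderiv ℝ (fun w : 𝔼 2 ↦ ((S.ν₀ (u, w) : 𝕊 3) : 𝔼 4)) 0 (EuclideanSpace.single j 1) := by
  rw [S.f_eq_fderiv_fibre j (ne_zero_of_mem_unit_sphere u)]
  have : (fun w : 𝔼 2 ↦ S.ν₀.coneTube ((u : 𝔼 2), w)) = fun w ↦ ((S.ν₀ (u, w) : 𝕊 3) : 𝔼 4) :=
    funext fun w ↦ S.ν₀.coneTube_coe u w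
  rw [this]

/-- The fibre derivatives are `C^∞` off the origin. [folklore] -/
theorem contDiffAt_f (j : Fin 2) {x : 𝔼 2} (hx : x ≠ 0) : ContDiffAt ℝ ∞ (S.f j) x := by
  have hD : ContDiffOn ℝ ∞ (fderiv ℝ S.ν₀.coneTube) {q : (𝔼 2) × (𝔼 2) | q.1 ≠ 0} :=
    S.ν₀.contDiffOn_coneTube.fderiv_of_isOpen Knot.TubularNbhd.isOpen_fst_ne_zero (by simp)
  have h1 : ContDiffAt ℝ ∞ (fun y : 𝔼 2 ↦ fderiv ℝ S.ν₀.coneTube (y, 0)) x :=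
    (hD.contDiffAt (Knot.TubularNbhd.isOpen_fst_ne_zero.mem_nhds (by exact hx))).comp x
      (contDiffAt_id.prodMk contDiffAt_const)
  exact h1.clm_apply contDiffAt_const

/-- **The fibre derivatives are transversal to the disc along the closed band** (the cone tube is an
immersion and the disc has the derivative of the cone there): at `u ∈ 𝕊¹`,
`Dg(r₀ u) v + ∑ aⱼ fⱼ u = 0 ⇒ v = 0 ∧ a = 0`. [folklore] -/
theorem transversal_f (u : 𝕊 1) (v a : 𝔼 2)
    (h : fderiv ℝ g (S.r₀ • (u : 𝔼 2)) v + ∑ j, a j • S.f j u = 0) : v = 0 ∧ a = 0 := by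
  have hu0 : (u : 𝔼 2) ≠ 0 := ne_zero_of_mem_unit_sphere u
  refine S.ν₀.transversal_coneTube_fibre hu0 v a ?_
  rw [← S.fderiv_g_ray u S.t₀_lt_r₀.le S.r₀_lt_one, S.ν₀.fderiv_coneTube_fibre_apply]
  convert h using 2
  refine Finset.sum_congr rfl fun j _ ↦ ?_
  rw [S.f_eq_fderiv_fibre j hu0]

/-- **The projected fibre frame** `Bⱼ x = P(r₀ x/‖x‖) (fⱼ x)`. [folklore] -/
def B (j : Fin 2) (x : 𝔼 2) : 𝔼 4 := S.P (S.r₀ • unitVec x) (S.f j x)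

/-- On the circle `Bⱼ u = P (r₀ u) (fⱼ u)`. [folklore] -/
theorem B_coe (j : Fin 2) (u : 𝕊 1) : S.B j u = S.P (S.r₀ • (u : 𝔼 2)) (S.f j u) := by
  rw [B, unitVec_coe]

/-- The projected fibre frame is `C^∞` off the origin. [folklore] -/
theorem contDiffAt_B (j : Fin 2) {x : 𝔼 2} (hx : x ≠ 0) : ContDiffAt ℝ ∞ (S.B j) x := by
  have hmem : S.r₀ • unitVec x ∈ ball (0 : 𝔼 2) S.R' := by
    rw [mem_ball_zero_iff, norm_smul, norm_unitVec hx, mul_one, Real.norm_of_nonneg S.r₀_pos.le]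
    exact S.r₀_lt_R'
  have hP : ContDiffAt ℝ ∞ (fun y : 𝔼 2 ↦ S.P (S.r₀ • unitVec y)) x :=
    (S.contDiffAt_P hmem).comp x ((contDiffAt_unitVec hx).const_smul S.r₀)
  exact hP.clm_apply (S.contDiffAt_f j hx)

/-- The projected fibre frame is normal: `P (r₀ u) (Bⱼ u) = Bⱼ u`. [folklore] -/
theorem P_B (j : Fin 2) (u : 𝕊 1) : S.P (S.r₀ • (u : 𝔼 2)) (S.B j u) = S.B j u := by
  rw [B_coe]
  exact normProj_normProj (S.injective_fderiv_r₀ u) _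

/-- **The projected fibre frame is linearly independent.** [folklore] -/
theorem linearIndependent_B (u : 𝕊 1) : LinearIndependent ℝ (fun j ↦ S.B j u) := by
  simp only [B_coe, P_apply]
  exact (transversal_iff_linearIndependent_normProj (S.injective_fderiv_r₀ u) (fun j ↦ S.f j u)).1
    (S.transversal_f u)

/-- The boundary frame lies in the span of the projected fibre frame. [folklore] -/
theorem exists_sum_smul_B_eq_N (i : Fin 2) (u : 𝕊 1) : ∃ c : Fin 2 → ℝ, ∑ j, c j • S.B j u = S.N i u :=
  exists_sum_smul_eq_of_normProj_eq (S.injective_fderiv_r₀ u) (S.linearIndependent_B u)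
    (fun j ↦ S.P_B j u) (S.P_N i u)

/-! #### The change of frame `M` -/

/-- **The change-of-frame coefficients** `m i x ∈ ℝ²`: `Nᵢ = ∑ⱼ (m i)ⱼ • Bⱼ` on the circle. [folklore] -/
def m (i : Fin 2) (x : 𝔼 2) : 𝔼 2 := frameCoeff (fun j ↦ S.B j x) (S.N i x)

/-- **`∑ⱼ (m i u)ⱼ • Bⱼ u = Nᵢ u`.** [folklore] -/
theorem sum_m_smul_B (i : Fin 2) (u : 𝕊 1) : ∑ j, (S.m i u) j • S.B j u = S.N i u :=
  sum_frameCoeff_smul (S.linearIndependent_B u) (S.exists_sum_smul_B_eq_N i u)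

/-- The coefficients are `C^∞` at every point of the circle. [folklore] -/
theorem contDiffAt_m (i : Fin 2) (u : 𝕊 1) : ContDiffAt ℝ ∞ (S.m i) (u : 𝔼 2) := by
  have hu0 : (u : 𝔼 2) ≠ 0 := ne_zero_of_mem_unit_sphere u
  unfold m
  exact contDiffAt_frameCoeff (fun j ↦ S.contDiffAt_B j hu0) (S.contDiffAt_N i hu0)
    (S.linearIndependent_B u)

/-- The two coefficient vectors are linearly independent. [folklore] -/
theorem linearIndependent_m (u : 𝕊 1) : LinearIndependent ℝ ![S.m 0 u, S.m 1 u] := by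
  rw [Fintype.linearIndependent_iff]
  intro c hc
  rw [Fin.sum_univ_two] at hc
  simp only [Matrix.cons_val_zero, Matrix.cons_val_one] at hc
  -- apply `frameCLM B`
  have h := congrArg (frameCLM fun j ↦ S.B j u) hc
  rw [map_add, map_smul, map_smul, map_zero, frameCLM_apply, frameCLM_apply, S.sum_m_smul_B,
    S.sum_m_smul_B] at h
  have hN := (Fintype.linearIndependent_iff.1 (S.linearIndependent_N u)) c
    (by rw [Fin.sum_univ_two]; exact h)
  exact hN

/-- **The determinant** of the change of frame. [folklore] -/
def det (x : 𝔼 2) : ℝ := (S.m 0 x) 0 * (S.m 1 x) 1 - (S.m 1 x) 0 * (S.m 0 x) 1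

/-- The determinant does not vanish on the circle. [folklore] -/
theorem det_ne_zero (u : 𝕊 1) : S.det u ≠ 0 := det_two_ne_zero_of_linearIndependent (S.linearIndependent_m u)

/-- A coordinate of a coefficient vector is `C^∞` at every point of the circle. [folklore] -/
theorem contDiffAt_m_coord (i k : Fin 2) (u : 𝕊 1) : ContDiffAt ℝ ∞ (fun x ↦ (S.m i x) k) (u : 𝔼 2) :=
  (EuclideanSpace.proj k : 𝔼 2 →L[ℝ] ℝ).contDiff.contDiffAt.comp (u : 𝔼 2) (S.contDiffAt_m i u)

/-- The determinant is `C^∞` at every point of the circle. [folklore] -/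
theorem contDiffAt_det (u : 𝕊 1) : ContDiffAt ℝ ∞ S.det (u : 𝔼 2) := by
  unfold det
  exact ((S.contDiffAt_m_coord 0 0 u).mul (S.contDiffAt_m_coord 1 1 u)).sub
    ((S.contDiffAt_m_coord 1 0 u).mul (S.contDiffAt_m_coord 0 1 u))

/-- The determinant is a continuous function of the angle. [folklore] -/
theorem continuous_det_circlePoint : Continuous fun θ : ℝ ↦ S.det ((circlePoint θ : 𝕊 1) : 𝔼 2) := by
  have h1 : Continuous fun θ : ℝ ↦ ((circlePoint θ : 𝕊 1) : 𝔼 2) :=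
    continuous_subtype_val.comp contMDiff_circlePoint.continuous
  exact continuous_iff_continuousAt.2 fun θ ↦
    (S.contDiffAt_det (circlePoint θ)).continuousAt.comp_of_eq h1.continuousAt rfl

/-- **The determinant has constant sign on the circle**: if it is positive at `circlePoint 0` it is
positive everywhere (intermediate value theorem along the angle). [folklore] -/
theorem det_pos_of_det_pos_zero (h0 : 0 < S.det ((circlePoint 0 : 𝕊 1) : 𝔼 2)) (u : 𝕊 1) : 0 < S.det u := by
  obtain ⟨θ, rfl⟩ := circlePoint_surjective u
  by_contra hneg
  have hle : S.det ((circlePoint θ : 𝕊 1) : 𝔼 2) ≤ 0 := not_lt.1 hneg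
  obtain ⟨θ', hθ'⟩ : (0 : ℝ) ∈ range fun θ : ℝ ↦ S.det ((circlePoint θ : 𝕊 1) : 𝔼 2) :=
    intermediate_value_univ θ 0 S.continuous_det_circlePoint ⟨hle, h0.le⟩
  exact S.det_ne_zero (circlePoint θ') hθ'

/-! #### Flipping the second normal field -/

/-- **The setup with `F₁` replaced by `-F₁`** (to fix the sign of the determinant). [folklore] -/
def flip : FramingSetup K g s₁ where
  R' := S.R'
  F i := if i = 1 then (fun x ↦ -S.F 1 x) else S.F 0
  ν₀ := S.ν₀
  isSliceDisc := S.isSliceDisc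
  s₁_pos := S.s₁_pos
  s₁_lt_one := S.s₁_lt_one
  g_cone := S.g_cone
  one_lt_R' := S.one_lt_R'
  injective_fderiv := S.injective_fderiv
  contDiffOn_F i := by
    fin_cases i
    · exact S.contDiffOn_F 0
    · exact (S.contDiffOn_F 1).neg
  normProj_F x hx i := by
    fin_cases i
    · exact S.normProj_F x hx 0
    · change normProjField g x (-S.F 1 x) = -S.F 1 x
      rw [map_neg, S.normProj_F x hx 1]
  linearIndependent_F x hx := by
    have h := S.linearIndependent_F x hx
    rw [Fintype.linearIndependent_iff] at h ⊢
    intro c hc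
    have hc' : c 0 • S.F 0 x + -(c 1 • S.F 1 x) = 0 := by
      rw [Fin.sum_univ_two] at hc
      simpa only [Fin.isValue, one_ne_zero, zero_ne_one, ↓reduceIte, smul_neg] using hc
    have := h ![c 0, -c 1] (by
      rw [Fin.sum_univ_two]
      simpa only [Matrix.cons_val_zero, Matrix.cons_val_one, neg_smul] using hc')
    intro i
    fin_cases i
    · simpa using this 0
    · simpa using this 1

/-- The first field is unchanged by the flip. [folklore] -/
@[simp] theorem flip_F_zero : S.flip.F 0 = S.F 0 := rfl

/-- The second field is negated by the flip. [folklore] -/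
@[simp] theorem flip_F_one : S.flip.F 1 = fun x ↦ -S.F 1 x := rfl

/-- The tube is unchanged by the flip. [folklore] -/
@[simp] theorem flip_ν₀ : S.flip.ν₀ = S.ν₀ := rfl

/-- `P` is unchanged by the flip. [folklore] -/
@[simp] theorem flip_P : S.flip.P = S.P := rfl

/-- `f` is unchanged by the flip. [folklore] -/
@[simp] theorem flip_f : S.flip.f = S.f := rfl

/-- `B` is unchanged by the flip. [folklore] -/
@[simp] theorem flip_B : S.flip.B = S.B := by
  funext j x; rfl

/-- `N₀` is unchanged by the flip. [folklore] -/
@[simp] theorem flip_N_zero : S.flip.N 0 = S.N 0 := rfl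

/-- `N₁` is negated by the flip. [folklore] -/
@[simp] theorem flip_N_one : S.flip.N 1 = -S.N 1 := by
  funext x
  rfl

/-- `m 0` is unchanged by the flip. [folklore] -/
@[simp] theorem flip_m_zero : S.flip.m 0 = S.m 0 := by
  funext x
  simp [m]

/-- `m 1` is negated by the flip (the coefficient map is linear). [folklore] -/
@[simp] theorem flip_m_one : S.flip.m 1 = -S.m 1 := by
  funext x
  simp only [m, flip_B, flip_N_one, Pi.neg_apply, frameCoeff, map_neg]

/-- **The determinant changes sign under the flip.** [folklore] -/
theorem flip_det (x : 𝔼 2) : S.flip.det x = -S.det x := by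
  simp only [det, flip_m_zero, flip_m_one, Pi.neg_apply, PiLp.neg_apply]
  ring

end FramingSetup

/-! ### Stage 2: positive determinant, the reframed tube and its cone -/

/-- **Stage 2 of the construction**: Stage 1 with the change of frame of positive determinant.
[folklore] -/
structure FramingSetup₂ (K : Knot) (g : 𝔼 2 → 𝔼 4) (s₁ : ℝ) extends FramingSetup K g s₁ where
  det_pos : ∀ u : 𝕊 1, 0 < toFramingSetup.det u

/-- **Stage 2 exists**: flip `F₁` if the determinant is negative at `circlePoint 0`. [folklore] -/
theorem FramingSetup.nonempty_framingSetup₂ {K : Knot} {g : 𝔼 2 → 𝔼 4} {s₁ : ℝ} (S : FramingSetup K g s₁) :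
    Nonempty (FramingSetup₂ K g s₁) := by
  rcases lt_or_gt_of_ne (S.det_ne_zero (circlePoint 0)).symm with h | h
  · exact ⟨⟨S, S.det_pos_of_det_pos_zero h⟩⟩
  · refine ⟨⟨S.flip, S.flip.det_pos_of_det_pos_zero ?_⟩⟩
    rw [S.flip_det]
    linarith

namespace FramingSetup₂

variable {K : Knot} {g : 𝔼 2 → 𝔼 4} {s₁ : ℝ} (S : FramingSetup₂ K g s₁)

/-- A coordinate of a coefficient vector as a smooth function on the circle. [folklore] -/
theorem contMDiff_m_coord (i k : Fin 2) :
    ContMDiff (𝓡 1) 𝓘(ℝ, ℝ) ∞ fun u : 𝕊 1 ↦ (S.m i u) k := fun u ↦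
  (S.contDiffAt_m_coord i k u).comp_contMDiffAt (contMDiff_coe_sphere u)

/-- **The reframing loop** built from the change of frame: its matrix at `u` has columns `m 0 u`,
`m 1 u`. [folklore] -/
def R : FibreReframe where
  a u := (S.m 0 u) 0
  b u := (S.m 1 u) 0
  c u := (S.m 0 u) 1
  d u := (S.m 1 u) 1
  contMDiff_a := S.contMDiff_m_coord 0 0
  contMDiff_b := S.contMDiff_m_coord 1 0
  contMDiff_c := S.contMDiff_m_coord 0 1
  contMDiff_d := S.contMDiff_m_coord 1 1
  det_pos u := by
    have h := S.det_pos u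
    simp only [FramingSetup.det] at h
    linarith

/-- The reframing loop sends `eᵢ` to the coefficient vector `m i u`. [folklore] -/
theorem R_lin_single (u : 𝕊 1) (i : Fin 2) : S.R.lin u (EuclideanSpace.single i 1) = S.m i u := by
  fin_cases i <;> ext k <;> fin_cases k <;> simp [R]

/-- **The reframed tubular neighbourhood `ν = ν₀.reframe R`.** [folklore] -/
def ν : Knot.TubularNbhd K := S.ν₀.reframe S.R

/-- **The fibre derivative `cᵢ u = D_w|₀ ν(u, ·) eᵢ` of the reframed tube.** [folklore] -/
def c (i : Fin 2) (u : 𝕊 1) : 𝔼 4 :=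
  fderiv ℝ (fun w : 𝔼 2 ↦ ((S.ν (u, w) : 𝕊 3) : 𝔼 4)) 0 (EuclideanSpace.single i 1)

/-- `cᵢ u = ∑ⱼ (m i u)ⱼ • fⱼ u`. [folklore] -/
theorem c_eq_sum (i : Fin 2) (u : 𝕊 1) : S.c i u = ∑ j, (S.m i u) j • S.f j u := by
  rw [c, ν, S.ν₀.fderiv_reframe_fibre_zero, R_lin_single]
  conv_lhs => rw [euclideanSpace_two_decomp (S.m i u)]
  rw [map_add, map_smul, map_smul, Fin.sum_univ_two, S.f_coe, S.f_coe]

/-- **The normal projection of `cᵢ u` at the reference point is the boundary frame**: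
`P (r₀ u) (cᵢ u) = Nᵢ u = Fᵢ (r₀ • u)`. [folklore] -/
theorem P_c (i : Fin 2) (u : 𝕊 1) : S.P (S.r₀ • (u : 𝔼 2)) (S.c i u) = S.F i (S.r₀ • (u : 𝔼 2)) := by
  rw [c_eq_sum, map_sum, ← S.N_coe, ← S.sum_m_smul_B i u]
  refine Finset.sum_congr rfl fun j _ ↦ ?_
  rw [map_smul, S.B_coe]

/-- **The cone field** `cxᵢ x = D(ν.coneTube)(x, 0)(0, eᵢ)`, smooth off the origin and equal to
`t • cᵢ u` at `x = t • u`. [folklore] -/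
def cx (i : Fin 2) (x : 𝔼 2) : 𝔼 4 := fderiv ℝ S.ν.coneTube (x, 0) (0, EuclideanSpace.single i 1)

/-- The cone field on a cone point: `cxᵢ (t • u) = t • cᵢ u`. [folklore] -/
theorem cx_smul_coe (i : Fin 2) {t : ℝ} (ht : 0 < t) (u : 𝕊 1) :
    S.cx i (t • (u : 𝔼 2)) = t • S.c i u := by
  have hx : t • (u : 𝔼 2) ≠ 0 := smul_ne_zero ht.ne' (ne_zero_of_mem_unit_sphere u)
  rw [cx, ← fderiv_comp_prodMk_right S.ν.coneTube
    ((S.ν.contDiffAt_coneTube (q := (t • (u : 𝔼 2), 0)) hx).differentiableAt (by simp)),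
    S.ν.fderiv_coneTube_fibre ht]
  rfl

/-- The cone field is `C^∞` off the origin. [folklore] -/
theorem contDiffAt_cx (i : Fin 2) {x : 𝔼 2} (hx : x ≠ 0) : ContDiffAt ℝ ∞ (S.cx i) x := by
  have hD : ContDiffOn ℝ ∞ (fderiv ℝ S.ν.coneTube) {q : (𝔼 2) × (𝔼 2) | q.1 ≠ 0} :=
    S.ν.contDiffOn_coneTube.fderiv_of_isOpen Knot.TubularNbhd.isOpen_fst_ne_zero (by simp)
  have h1 : ContDiffAt ℝ ∞ (fun y : 𝔼 2 ↦ fderiv ℝ S.ν.coneTube (y, 0)) x :=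
    (hD.contDiffAt (Knot.TubularNbhd.isOpen_fst_ne_zero.mem_nhds (by exact hx))).comp x
      (contDiffAt_id.prodMk contDiffAt_const)
  exact h1.clm_apply contDiffAt_const

/-- **On the closed band the cone field is transversal**, indeed its normal projection is the
boundary frame: `P (t • u) (cxᵢ (t • u)) = t • Fᵢ (r₀ • u)` for `t₀ ≤ t < 1`. [folklore] -/
theorem P_cx (i : Fin 2) (u : 𝕊 1) {t : ℝ} (ht : S.t₀ ≤ t) (ht' : t < 1) :
    S.P (t • (u : 𝔼 2)) (S.cx i (t • (u : 𝔼 2))) = t • S.F i (S.r₀ • (u : 𝔼 2)) := by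
  rw [S.cx_smul_coe i (S.t₀_pos.trans_le ht) u, map_smul, S.P_ray u ht ht', S.P_c]

end FramingSetup₂


/-! ### Stage 3: the radial push and the deep frame -/

/-- **Stage 3 of the construction**: Stage 2 together with the radii `α < β ≤ t₀` of the radial push,
chosen so that the normal frame transported to the push of `x` stays transversal at `x`
(openness of transversality near the inner edge of the band). [folklore] -/
structure FramingSetup₃ (K : Knot) (g : 𝔼 2 → 𝔼 4) (s₁ : ℝ) extends FramingSetup₂ K g s₁ where
  /-- below `α` the push is the identity -/
  α : ℝ
  /-- above `β` the push is complete -/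
  β : ℝ
  α_pos : 0 < α
  α_lt_β : α < β
  β_le_t₀ : β ≤ toFramingSetup.t₀
  /-- transversality of the frame at pushed points, on the zone `α ≤ ‖x‖ ≤ t₀` -/
  indep_push : ∀ x : 𝔼 2, α ≤ ‖x‖ → ‖x‖ ≤ toFramingSetup.t₀ → ∀ s : ℝ, ‖x‖ ≤ s → s ≤ toFramingSetup.r₀ →
    LinearIndependent ℝ ![fderiv ℝ g x (EuclideanSpace.single 0 1), fderiv ℝ g x (EuclideanSpace.single 1 1),
      toFramingSetup.F 0 (s • unitVec x), toFramingSetup.F 1 (s • unitVec x)]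

namespace FramingSetup₂

variable {K : Knot} {g : 𝔼 2 → 𝔼 4} {s₁ : ℝ} (S : FramingSetup₂ K g s₁)

/-- The family of four vectors whose independence is transversality of the frame at `s • x/‖x‖` to the
disc at `x`. [folklore] -/
def pushFamily (p : (𝔼 2) × ℝ) : Fin 4 → 𝔼 4 :=
  ![fderiv ℝ g p.1 (EuclideanSpace.single 0 1), fderiv ℝ g p.1 (EuclideanSpace.single 1 1),
    S.F 0 (p.2 • unitVec p.1), S.F 1 (p.2 • unitVec p.1)]

/-- The open set on which the push family is continuous. [folklore] -/
def pushDom : Set ((𝔼 2) × ℝ) := {p | p.1 ≠ 0 ∧ |p.2| < S.R'}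

/-- The push domain is open. [folklore] -/
theorem isOpen_pushDom : IsOpen S.pushDom :=
  (isOpen_ne_fun continuous_fst continuous_const).inter
    (isOpen_lt (continuous_abs.comp continuous_snd) continuous_const)

/-- On the push domain the point `s • x/‖x‖` lies in the frame ball. [folklore] -/
theorem smul_unitVec_mem_ball {p : (𝔼 2) × ℝ} (hp : p ∈ S.pushDom) :
    p.2 • unitVec p.1 ∈ ball (0 : 𝔼 2) S.R' := by
  rw [mem_ball_zero_iff, norm_smul, norm_unitVec hp.1, mul_one, Real.norm_eq_abs]
  exact hp.2

/-- The push family is continuous on the push domain. [folklore] -/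
theorem continuousOn_pushFamily : ContinuousOn S.pushFamily S.pushDom := by
  have hd : Continuous (fderiv ℝ g) := S.contDiff_g.continuous_fderiv (by simp)
  have hq : ContinuousOn (fun p : (𝔼 2) × ℝ ↦ p.2 • unitVec p.1) S.pushDom := fun p hp ↦
    (continuous_snd.continuousAt.smul ((contDiffAt_unitVec hp.1).continuousAt.comp
      continuous_fst.continuousAt)).continuousWithinAt
  have hF : ∀ i, ContinuousOn (fun p : (𝔼 2) × ℝ ↦ S.F i (p.2 • unitVec p.1)) S.pushDom := fun i ↦
    (S.contDiffOn_F i).continuousOn.comp hq fun p hp ↦ S.smul_unitVec_mem_ball hp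
  refine continuousOn_pi.2 fun k ↦ ?_
  fin_cases k
  · exact ((hd.comp continuous_fst).clm_apply continuous_const).continuousOn
  · exact ((hd.comp continuous_fst).clm_apply continuous_const).continuousOn
  · exact hF 0
  · exact hF 1

/-- The compact reference set `{t₀ ≤ ‖x‖ ≤ r₀} × [t₀, r₀]`. [folklore] -/
def pushRef : Set ((𝔼 2) × ℝ) := {p | S.t₀ ≤ ‖p.1‖ ∧ ‖p.1‖ ≤ S.r₀ ∧ p.2 ∈ Icc S.t₀ S.r₀}

/-- The reference set is compact. [folklore] -/
theorem isCompact_pushRef : IsCompact S.pushRef := by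
  have h1 : IsCompact {x : 𝔼 2 | S.t₀ ≤ ‖x‖ ∧ ‖x‖ ≤ S.r₀} := by
    refine (isCompact_closedBall (0 : 𝔼 2) S.r₀).of_isClosed_subset ?_ fun x hx ↦ ?_
    · exact (isClosed_le continuous_const continuous_norm).inter (isClosed_le continuous_norm continuous_const)
    · exact mem_closedBall_zero_iff.2 hx.2
  have h : S.pushRef = {x : 𝔼 2 | S.t₀ ≤ ‖x‖ ∧ ‖x‖ ≤ S.r₀} ×ˢ Icc S.t₀ S.r₀ := by
    ext p; simp [pushRef, and_assoc]
  rw [h]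
  exact h1.prod isCompact_Icc

/-- The reference set lies in the push domain. [folklore] -/
theorem pushRef_subset : S.pushRef ⊆ S.pushDom := by
  intro p hp
  refine ⟨?_, ?_⟩
  · rw [← norm_pos_iff]; exact S.t₀_pos.trans_le hp.1
  · rw [abs_of_pos (S.t₀_pos.trans_le hp.2.2.1)]
    exact hp.2.2.2.trans_lt S.r₀_lt_R'

/-- **On the reference set the push family is linearly independent** (the tangent plane is constant
along the conical ray, where the frame is a normal frame). [folklore] -/
theorem linearIndependent_pushFamily {p : (𝔼 2) × ℝ} (hp : p ∈ S.pushRef) :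
    LinearIndependent ℝ (S.pushFamily p) := by
  obtain ⟨x, s⟩ := p
  obtain ⟨h1, h2, hs1, hs2⟩ := hp
  change S.t₀ ≤ ‖x‖ at h1
  change ‖x‖ ≤ S.r₀ at h2
  set u : 𝕊 1 := radialProjection (spherePt 1) x with hu
  have hx : x = ‖x‖ • (u : 𝔼 2) := eq_norm_smul_radialProjection x
  have hxpos : 0 < ‖x‖ := S.t₀_pos.trans_le h1
  have hunit : unitVec x = u := by
    conv_lhs => rw [hx]
    exact unitVec_smul_coe hxpos u
  -- the derivative at `x` and at `s • u` agree
  have hL : fderiv ℝ g x = fderiv ℝ g (s • (u : 𝔼 2)) := by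
    conv_lhs => rw [hx]
    rw [S.fderiv_g_ray_eq u h1 (h2.trans_lt S.r₀_lt_one), S.fderiv_g_ray_eq u hs1 (hs2.trans_lt S.r₀_lt_one)]
  have hsmem : s • (u : 𝔼 2) ∈ ball (0 : 𝔼 2) S.R' :=
    S.smul_coe_mem_ball (by rw [abs_of_pos (S.t₀_pos.trans_le hs1)]; exact hs2.trans_lt S.r₀_lt_R') u
  have hLinj : Injective (fderiv ℝ g (s • (u : 𝔼 2))) := S.injective_fderiv _ hsmem
  have htr : ∀ (v a : 𝔼 2), fderiv ℝ g (s • (u : 𝔼 2)) v + ∑ i, a i • S.F i (s • (u : 𝔼 2)) = 0 →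
      v = 0 ∧ a = 0 := by
    rw [transversal_iff_linearIndependent_normProj hLinj]
    have : (fun i ↦ normProj (fderiv ℝ g (s • (u : 𝔼 2))) (S.F i (s • (u : 𝔼 2)))) =
        fun i ↦ S.F i (s • (u : 𝔼 2)) := funext fun i ↦ S.normProj_F _ hsmem i
    rw [this]
    exact S.linearIndependent_F _ hsmem
  have h4 := (transversal_iff_linearIndependent_four (fun i ↦ S.F i (s • (u : 𝔼 2)))).1 htr
  change LinearIndependent ℝ ![fderiv ℝ g x (EuclideanSpace.single 0 1),
    fderiv ℝ g x (EuclideanSpace.single 1 1), S.F 0 (s • unitVec x), S.F 1 (s • unitVec x)]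
  rw [hunit, hL]
  exact h4

include S in
/-- **Stage 3 exists**: the radii of the push from the uniform thickening. [folklore] -/
theorem nonempty_framingSetup₃ : Nonempty (FramingSetup₃ K g s₁) := by
  obtain ⟨δ, hδ, hthick⟩ := exists_thickening_linearIndependent S.isOpen_pushDom S.continuousOn_pushFamily
    S.isCompact_pushRef S.pushRef_subset fun p hp ↦ S.linearIndependent_pushFamily hp
  set η : ℝ := min (δ / 2) (S.t₀ / 2) with hη
  have hη0 : 0 < η := lt_min (by linarith) (by linarith [S.t₀_pos])
  have hηδ : η < δ := (min_le_left _ _).trans_lt (by linarith)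
  have hηt : η ≤ S.t₀ / 2 := min_le_right _ _
  refine ⟨{ S with
    α := S.t₀ - η, β := S.t₀ - η / 2,
    α_pos := by linarith [S.t₀_pos], α_lt_β := by linarith, β_le_t₀ := by linarith,
    indep_push := ?_ }⟩
  intro x hx1 hx2 s hs1 hs2
  have hxpos : 0 < ‖x‖ := by linarith [S.t₀_pos]
  have hx0 : x ≠ 0 := norm_pos_iff.1 hxpos
  -- the witness in the reference set
  set x' : 𝔼 2 := (S.t₀ / ‖x‖) • x with hx'
  set s' : ℝ := max s S.t₀ with hs'
  have hnx' : ‖x'‖ = S.t₀ := by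
    rw [hx', norm_smul, Real.norm_of_nonneg (div_nonneg S.t₀_pos.le (norm_nonneg _)),
      div_mul_cancel₀ _ hxpos.ne']
  have hmem : ((x', s') : (𝔼 2) × ℝ) ∈ S.pushRef :=
    ⟨hnx'.ge, by rw [hnx']; exact S.t₀_lt_r₀.le, le_max_right _ _, max_le hs2 S.t₀_lt_r₀.le⟩
  have hdist : dist ((x, s) : (𝔼 2) × ℝ) (x', s') < δ := by
    rw [Prod.dist_eq, max_lt_iff]
    constructor
    · rw [dist_eq_norm, hx', show x - (S.t₀ / ‖x‖) • x = (1 - S.t₀ / ‖x‖) • x by rw [sub_smul, one_smul],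
        norm_smul, show (1 - S.t₀ / ‖x‖) = (‖x‖ - S.t₀) / ‖x‖ by field_simp, norm_div, Real.norm_of_nonneg hxpos.le,
        Real.norm_of_nonpos (by linarith), div_mul_cancel₀ _ hxpos.ne']
      linarith
    · rw [Real.dist_eq, hs']
      rcases le_or_gt S.t₀ s with h | h
      · rw [max_eq_left h, sub_self, abs_zero]; exact hδ
      · rw [max_eq_right h.le, abs_of_nonpos (by linarith)]
        linarith
  have hp := (hthick (x, s) (mem_thickening_iff.2 ⟨(x', s'), hmem, hdist⟩)).2
  exact hp

end FramingSetup₂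

namespace FramingSetup₃

variable {K : Knot} {g : 𝔼 2 → 𝔼 4} {s₁ : ℝ} (S : FramingSetup₃ K g s₁)

/-- `β < r₀`. [folklore] -/
theorem β_lt_r₀ : S.β < S.r₀ := S.β_le_t₀.trans_lt S.t₀_lt_r₀

/-- **The radial push** of Stage 3. [folklore] -/
def ρ : 𝔼 2 → 𝔼 2 := radialPush S.α S.β S.r₀

/-- The push is `C^∞`. [folklore] -/
theorem contDiff_ρ : ContDiff ℝ ∞ S.ρ := contDiff_radialPush S.α_pos S.α_lt_β

/-- The push is the identity below `α`. [folklore] -/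
theorem ρ_of_le {x : 𝔼 2} (hx : ‖x‖ ≤ S.α) : S.ρ x = x := radialPush_of_le S.α_lt_β hx

/-- The push of a point of the closed band: `ρ (t • u) = r₀ • u` for `β ≤ t`. [folklore] -/
theorem ρ_smul_coe {t : ℝ} (ht : S.β ≤ t) (u : 𝕊 1) : S.ρ (t • (u : 𝔼 2)) = S.r₀ • (u : 𝔼 2) := by
  have htpos : 0 < t := (S.α_pos.trans S.α_lt_β).trans_le ht
  rw [ρ, radialPush_of_ge S.α_lt_β (by rwa [norm_smul_coe_sphere htpos.le]), norm_smul_coe_sphere htpos.le,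
    smul_smul, div_mul_cancel₀ _ htpos.ne']

/-- The push maps the open unit disc into the frame ball. [folklore] -/
theorem ρ_mem_ball {x : 𝔼 2} (hx : x ∈ ball (0 : 𝔼 2) 1) : S.ρ x ∈ ball (0 : 𝔼 2) S.R' := by
  rw [mem_ball_zero_iff] at hx ⊢
  by_cases h0 : x = 0
  · subst h0
    rw [S.ρ_of_le (by simp [S.α_pos.le])]
    simpa using S.r₀_pos.trans S.r₀_lt_R'
  · have h := (norm_radialPush_mem_uIcc (α := S.α) (β := S.β) S.r₀_pos.le h0).2
    exact lt_of_le_of_lt h (max_lt (hx.trans S.one_lt_R') S.r₀_lt_R')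

/-- Off the origin the push is `‖ρ x‖ • x/‖x‖` with `‖x‖ ≤ ‖ρ x‖ ≤ r₀` when `‖x‖ ≤ r₀`. [folklore] -/
theorem ρ_eq_smul_unitVec {x : 𝔼 2} (hx : x ≠ 0) : S.ρ x = ‖S.ρ x‖ • unitVec x := by
  rw [unitVec_eq hx, smul_smul, ← div_eq_mul_inv]
  exact radialPush_eq_norm_smul S.r₀_pos hx

/-- The norm of the push lies between `‖x‖` and `r₀` (for `‖x‖ ≤ r₀`). [folklore] -/
theorem norm_ρ_mem {x : 𝔼 2} (hx : x ≠ 0) (hxr : ‖x‖ ≤ S.r₀) : ‖x‖ ≤ ‖S.ρ x‖ ∧ ‖S.ρ x‖ ≤ S.r₀ := by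
  have h := norm_radialPush_mem_uIcc (α := S.α) (β := S.β) S.r₀_pos.le hx
  rw [min_eq_left hxr, max_eq_right hxr] at h
  exact h

/-- **The deep frame** `nᵢ x = P(x) Fᵢ(ρ x)`. [folklore] -/
def n (i : Fin 2) (x : 𝔼 2) : 𝔼 4 := S.P x (S.F i (S.ρ x))

/-- The deep frame is `C^∞` on the open unit disc. [folklore] -/
theorem contDiffAt_n (i : Fin 2) {x : 𝔼 2} (hx : x ∈ ball (0 : 𝔼 2) 1) : ContDiffAt ℝ ∞ (S.n i) x := by
  have hF : ContDiffAt ℝ ∞ (fun y ↦ S.F i (S.ρ y)) x :=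
    ((S.contDiffOn_F i).contDiffAt (isOpen_ball.mem_nhds (S.ρ_mem_ball hx))).comp x S.contDiff_ρ.contDiffAt
  exact (S.contDiffAt_P (S.ball_subset hx)).clm_apply hF

/-- The deep frame is `C^∞` on the open unit disc. [folklore] -/
theorem contDiffOn_n (i : Fin 2) : ContDiffOn ℝ ∞ (S.n i) (ball (0 : 𝔼 2) 1) := fun _ hx ↦
  (S.contDiffAt_n i hx).contDiffWithinAt

/-- The deep frame is normal: `P x (nᵢ x) = nᵢ x` on the frame ball. [folklore] -/
theorem P_n (i : Fin 2) {x : 𝔼 2} (hx : x ∈ ball (0 : 𝔼 2) S.R') : S.P x (S.n i x) = S.n i x :=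
  normProj_normProj (S.injective_fderiv x hx) _

/-- **On the closed band the deep frame is the boundary frame**: `nᵢ (t • u) = Fᵢ (r₀ • u)` for
`t₀ ≤ t < 1`. [folklore] -/
theorem n_smul_coe (i : Fin 2) (u : 𝕊 1) {t : ℝ} (ht : S.t₀ ≤ t) (ht' : t < 1) :
    S.n i (t • (u : 𝔼 2)) = S.F i (S.r₀ • (u : 𝔼 2)) := by
  rw [n, S.ρ_smul_coe (S.β_le_t₀.trans ht), S.P_ray u ht ht']
  exact S.normProj_F _ (S.r₀_smul_mem_ball u) i

/-- **The deep frame is transversal below the inner edge** (`‖x‖ ≤ t₀`, `x` in the unit disc).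
[folklore] -/
theorem transversal_n {x : 𝔼 2} (hx : x ∈ ball (0 : 𝔼 2) 1) (hxt : ‖x‖ ≤ S.t₀) (v a : 𝔼 2)
    (h : fderiv ℝ g x v + ∑ i, a i • S.n i x = 0) : v = 0 ∧ a = 0 := by
  have hxR : x ∈ ball (0 : 𝔼 2) S.R' := S.ball_subset hx
  have hL : Injective (fderiv ℝ g x) := S.injective_fderiv x hxR
  -- it suffices that the normal projections (the `nᵢ x` themselves) are independent
  refine (transversal_iff_linearIndependent_normProj hL (fun i ↦ S.n i x)).2 ?_ v a h
  have hfix : (fun i ↦ normProj (fderiv ℝ g x) (S.n i x)) = fun i ↦ S.n i x := funext fun i ↦ S.P_n i hxR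
  rw [hfix]
  by_cases hα : ‖x‖ ≤ S.α
  · -- below `α` the push is the identity and `nᵢ x = Fᵢ x`
    have : (fun i ↦ S.n i x) = fun i ↦ S.F i x := funext fun i ↦ by
      rw [n, S.ρ_of_le hα]; exact S.normProj_F x hxR i
    rw [this]
    exact S.linearIndependent_F x hxR
  · -- on the push zone: openness of transversality
    have hx0 : x ≠ 0 := by rw [← norm_pos_iff]; linarith [not_le.1 hα, S.α_pos]
    obtain ⟨hs1, hs2⟩ := S.norm_ρ_mem hx0 (hxt.trans S.t₀_lt_r₀.le)
    have h4 := S.indep_push x (not_le.1 hα).le hxt ‖S.ρ x‖ hs1 hs2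
    rw [← S.ρ_eq_smul_unitVec hx0] at h4
    have htr := (transversal_iff_linearIndependent_four (fun i ↦ S.F i (S.ρ x))).2 h4
    exact (transversal_iff_linearIndependent_normProj hL (fun i ↦ S.F i (S.ρ x))).1 htr

end FramingSetup₃

/-! ### Stage 4: the cut-off and the blended framing -/

/-- **Stage 4 of the construction**: Stage 3 together with the radii `γ₁ < γ₂ < t₀` of the cut-off,
chosen so that every blend of the deep frame and the cone field is transversal on `γ₁ ≤ ‖x‖ ≤ t₀`.
[folklore] -/
structure FramingSetup₄ (K : Knot) (g : 𝔼 2 → 𝔼 4) (s₁ : ℝ) extends FramingSetup₃ K g s₁ where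
  /-- below `γ₁` the cut-off vanishes -/
  γ₁ : ℝ
  /-- above `γ₂` the cut-off is `1` -/
  γ₂ : ℝ
  γ₁_pos : 0 < γ₁
  γ₁_lt_γ₂ : γ₁ < γ₂
  γ₂_lt_t₀ : γ₂ < toFramingSetup.t₀
  /-- transversality of every blend, on the zone `γ₁ ≤ ‖x‖ ≤ t₀` -/
  indep_blend : ∀ x : 𝔼 2, γ₁ ≤ ‖x‖ → ‖x‖ ≤ toFramingSetup.t₀ → ∀ l ∈ Icc (0 : ℝ) 1,
    LinearIndependent ℝ ![fderiv ℝ g x (EuclideanSpace.single 0 1), fderiv ℝ g x (EuclideanSpace.single 1 1),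
      (1 - l) • toFramingSetup₃.n 0 x + l • toFramingSetup₂.cx 0 x,
      (1 - l) • toFramingSetup₃.n 1 x + l • toFramingSetup₂.cx 1 x]

namespace FramingSetup₃

variable {K : Knot} {g : 𝔼 2 → 𝔼 4} {s₁ : ℝ} (S : FramingSetup₃ K g s₁)

/-- The family of four vectors whose independence is transversality of the blend with weight `l`.
[folklore] -/
def blendFamily (p : (𝔼 2) × ℝ) : Fin 4 → 𝔼 4 :=
  ![fderiv ℝ g p.1 (EuclideanSpace.single 0 1), fderiv ℝ g p.1 (EuclideanSpace.single 1 1),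
    (1 - p.2) • S.n 0 p.1 + p.2 • S.cx 0 p.1, (1 - p.2) • S.n 1 p.1 + p.2 • S.cx 1 p.1]

/-- The open set on which the blend family is continuous (the setup is not used). [folklore] -/
def blendDom (_S : FramingSetup₃ K g s₁) : Set ((𝔼 2) × ℝ) := {p | p.1 ≠ 0 ∧ ‖p.1‖ < 1}

/-- The blend domain is open. [folklore] -/
theorem isOpen_blendDom : IsOpen S.blendDom :=
  (isOpen_ne_fun continuous_fst continuous_const).inter
    (isOpen_lt (continuous_norm.comp continuous_fst) continuous_const)

/-- The blend family is continuous on the blend domain. [folklore] -/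
theorem continuousOn_blendFamily : ContinuousOn S.blendFamily S.blendDom := by
  have hd : Continuous (fderiv ℝ g) := S.contDiff_g.continuous_fderiv (by simp)
  have hW : ∀ i, ContinuousOn (fun p : (𝔼 2) × ℝ ↦ (1 - p.2) • S.n i p.1 + p.2 • S.cx i p.1) S.blendDom := by
    intro i p hp
    have hn : ContinuousAt (fun p : (𝔼 2) × ℝ ↦ S.n i p.1) p :=
      (S.contDiffAt_n i (mem_ball_zero_iff.2 hp.2)).continuousAt.comp continuous_fst.continuousAt
    have hc : ContinuousAt (fun p : (𝔼 2) × ℝ ↦ S.cx i p.1) p :=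
      (S.contDiffAt_cx i hp.1).continuousAt.comp continuous_fst.continuousAt
    exact (((continuous_const.sub continuous_snd).continuousAt.smul hn).add
      (continuous_snd.continuousAt.smul hc)).continuousWithinAt
  refine continuousOn_pi.2 fun k ↦ ?_
  fin_cases k
  · exact ((hd.comp continuous_fst).clm_apply continuous_const).continuousOn
  · exact ((hd.comp continuous_fst).clm_apply continuous_const).continuousOn
  · exact hW 0
  · exact hW 1

/-- The compact reference set `{‖x‖ = t₀} × [0, 1]`. [folklore] -/
def blendRef : Set ((𝔼 2) × ℝ) := {p | ‖p.1‖ = S.t₀ ∧ p.2 ∈ Icc (0 : ℝ) 1}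

/-- The reference set is compact. [folklore] -/
theorem isCompact_blendRef : IsCompact S.blendRef := by
  have h : S.blendRef = sphere (0 : 𝔼 2) S.t₀ ×ˢ Icc (0 : ℝ) 1 := by
    ext p; simp [blendRef]
  rw [h]
  exact (isCompact_sphere _ _).prod isCompact_Icc

/-- The reference set lies in the blend domain. [folklore] -/
theorem blendRef_subset : S.blendRef ⊆ S.blendDom := fun p hp ↦
  ⟨by rw [← norm_pos_iff, hp.1]; exact S.t₀_pos, by rw [hp.1]; exact S.t₀_lt_one⟩

/-- **On the reference set every blend is transversal**: at `x = t₀ • u` the normal projection of the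
blend is `((1 - l) + l t₀) • Fᵢ (r₀ • u)`. [folklore] -/
theorem linearIndependent_blendFamily {p : (𝔼 2) × ℝ} (hp : p ∈ S.blendRef) :
    LinearIndependent ℝ (S.blendFamily p) := by
  obtain ⟨x, l⟩ := p
  obtain ⟨hx, hl0, hl1⟩ := hp
  change ‖x‖ = S.t₀ at hx
  set u : 𝕊 1 := radialProjection (spherePt 1) x with hu
  have hxu : x = S.t₀ • (u : 𝔼 2) := by rw [← hx]; exact eq_norm_smul_radialProjection x
  have hxR : x ∈ ball (0 : 𝔼 2) S.R' := S.ball_subset (mem_ball_zero_iff.2 (by rw [hx]; exact S.t₀_lt_one))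
  have hL : Injective (fderiv ℝ g x) := S.injective_fderiv x hxR
  -- the normal projections of the two blended vectors
  set κ : ℝ := (1 - l) + l * S.t₀ with hκ
  have hκ0 : κ ≠ 0 := by
    have : S.t₀ ≤ κ := by rw [hκ]; nlinarith [S.t₀_lt_one, S.t₀_pos]
    linarith [S.t₀_pos]
  have hproj : ∀ i, normProj (fderiv ℝ g x) ((1 - l) • S.n i x + l • S.cx i x) =
      κ • S.F i (S.r₀ • (u : 𝔼 2)) := by
    intro i
    rw [map_add, map_smul, map_smul, ← S.P_apply, hxu, S.P_n i (by rw [← hxu]; exact hxR),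
      S.n_smul_coe i u le_rfl S.t₀_lt_one, S.P_cx i u le_rfl S.t₀_lt_one, smul_smul, ← add_smul]
  have htr : ∀ (v a : 𝔼 2), fderiv ℝ g x v + ∑ i, a i • ((1 - l) • S.n i x + l • S.cx i x) = 0 →
      v = 0 ∧ a = 0 := by
    rw [transversal_iff_linearIndependent_normProj hL]
    simp_rw [hproj]
    have hF := S.linearIndependent_F _ (S.r₀_smul_mem_ball u)
    rw [Fintype.linearIndependent_iff] at hF ⊢
    intro c hc
    have h' := hF (fun i ↦ c i * κ) (by
      simpa only [mul_smul, ← Finset.smul_sum] using hc)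
    intro i
    exact (mul_eq_zero.1 (h' i)).resolve_right hκ0
  exact (transversal_iff_linearIndependent_four (fun i ↦ (1 - l) • S.n i x + l • S.cx i x)).1 htr

include S in
/-- **Stage 4 exists**: the radii of the cut-off from the uniform thickening. [folklore] -/
theorem nonempty_framingSetup₄ : Nonempty (FramingSetup₄ K g s₁) := by
  obtain ⟨δ, hδ, hthick⟩ := exists_thickening_linearIndependent S.isOpen_blendDom S.continuousOn_blendFamily
    S.isCompact_blendRef S.blendRef_subset fun p hp ↦ S.linearIndependent_blendFamily hp
  set η : ℝ := min (δ / 2) (S.t₀ / 2) with hη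
  have hη0 : 0 < η := lt_min (by linarith) (by linarith [S.t₀_pos])
  have hηδ : η < δ := (min_le_left _ _).trans_lt (by linarith)
  have hηt : η ≤ S.t₀ / 2 := min_le_right _ _
  refine ⟨{ S with
    γ₁ := S.t₀ - η, γ₂ := S.t₀ - η / 2,
    γ₁_pos := by linarith [S.t₀_pos], γ₁_lt_γ₂ := by linarith, γ₂_lt_t₀ := by linarith,
    indep_blend := ?_ }⟩
  intro x hx1 hx2 l hl
  have hxpos : 0 < ‖x‖ := by linarith [S.t₀_pos]
  have hx0 : x ≠ 0 := norm_pos_iff.1 hxpos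
  set x' : 𝔼 2 := (S.t₀ / ‖x‖) • x with hx'
  have hnx' : ‖x'‖ = S.t₀ := by
    rw [hx', norm_smul, Real.norm_of_nonneg (div_nonneg S.t₀_pos.le (norm_nonneg _)),
      div_mul_cancel₀ _ hxpos.ne']
  have hmem : ((x', l) : (𝔼 2) × ℝ) ∈ S.blendRef := ⟨hnx', hl⟩
  have hdist : dist ((x, l) : (𝔼 2) × ℝ) (x', l) < δ := by
    rw [Prod.dist_eq, max_lt_iff, dist_self]
    refine ⟨?_, hδ⟩
    rw [dist_eq_norm, hx', show x - (S.t₀ / ‖x‖) • x = (1 - S.t₀ / ‖x‖) • x by rw [sub_smul, one_smul],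
      norm_smul, show (1 - S.t₀ / ‖x‖) = (‖x‖ - S.t₀) / ‖x‖ by field_simp, norm_div, Real.norm_of_nonneg hxpos.le,
      Real.norm_of_nonpos (by linarith), div_mul_cancel₀ _ hxpos.ne']
    linarith
  exact (hthick (x, l) (mem_thickening_iff.2 ⟨(x', l), hmem, hdist⟩)).2

end FramingSetup₃

namespace FramingSetup₄

variable {K : Knot} {g : 𝔼 2 → 𝔼 4} {s₁ : ℝ} (S : FramingSetup₄ K g s₁)

/-- **The cut-off** of Stage 4. [folklore] -/
def φ : 𝔼 2 → ℝ := radialCut S.γ₁ S.γ₂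

/-- The cut-off is `C^∞`. [folklore] -/
theorem contDiff_φ : ContDiff ℝ ∞ S.φ := contDiff_radialCut S.γ₁_pos S.γ₁_lt_γ₂

/-- The cut-off vanishes below `γ₁`. [folklore] -/
theorem φ_of_le {x : 𝔼 2} (hx : ‖x‖ ≤ S.γ₁) : S.φ x = 0 := radialCut_of_le S.γ₁_lt_γ₂ hx

/-- The cut-off is `1` above `γ₂`. [folklore] -/
theorem φ_of_ge {x : 𝔼 2} (hx : S.γ₂ ≤ ‖x‖) : S.φ x = 1 := radialCut_of_ge S.γ₁_lt_γ₂ hx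

/-- The cut-off lies in `[0, 1]`. [folklore] -/
theorem φ_mem (x : 𝔼 2) : S.φ x ∈ Icc (0 : ℝ) 1 := radialCut_mem x

/-- **The blended framing** `n'ᵢ = (1 - φ) nᵢ + φ cxᵢ`. [folklore] -/
def frame (i : Fin 2) (x : 𝔼 2) : 𝔼 4 := (1 - S.φ x) • S.n i x + S.φ x • S.cx i x

/-- **The width `s₂ = 1 - γ₂` of the band on which the framing is conical.** [folklore] -/
def s₂ : ℝ := 1 - S.γ₂

/-- `s₁ < s₂`. [folklore] -/
theorem s₁_lt_s₂ : s₁ < S.s₂ := by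
  have h := S.γ₂_lt_t₀
  unfold s₂; unfold FramingSetup.t₀ at h; linarith

/-- `s₂ < 1`. [folklore] -/
theorem s₂_lt_one : S.s₂ < 1 := by
  unfold s₂; linarith [S.γ₁_pos, S.γ₁_lt_γ₂]

/-- Below `γ₁` the blended framing is the deep frame. [folklore] -/
theorem frame_of_le (i : Fin 2) {x : 𝔼 2} (hx : ‖x‖ ≤ S.γ₁) : S.frame i x = S.n i x := by
  rw [frame, S.φ_of_le hx]; simp

/-- Above `γ₂` the blended framing is the cone field. [folklore] -/
theorem frame_of_ge (i : Fin 2) {x : 𝔼 2} (hx : S.γ₂ ≤ ‖x‖) : S.frame i x = S.cx i x := by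
  rw [frame, S.φ_of_ge hx]; simp

/-- **The blended framing is `C^∞` on the open unit disc.** [folklore] -/
theorem contDiffOn_frame (i : Fin 2) : ContDiffOn ℝ ∞ (S.frame i) (ball (0 : 𝔼 2) 1) := by
  intro x hx
  by_cases h : ‖x‖ < S.γ₁
  · -- near `x` the framing is the deep frame
    have hev : S.frame i =ᶠ[𝓝 x] S.n i :=
      Filter.eventuallyEq_of_mem ((isOpen_lt continuous_norm continuous_const).mem_nhds h)
        fun y hy ↦ S.frame_of_le i (le_of_lt hy)
    exact ((S.contDiffAt_n i hx).congr_of_eventuallyEq hev).contDiffWithinAt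
  · have hx0 : x ≠ 0 := by rw [← norm_pos_iff]; linarith [not_lt.1 h, S.γ₁_pos]
    have hφ := S.contDiff_φ.contDiffAt (x := x)
    exact (((contDiffAt_const.sub hφ).smul (S.contDiffAt_n i hx)).add
      (hφ.smul (S.contDiffAt_cx i hx0))).contDiffWithinAt

/-- **The blended framing is transversal on the open unit disc.** [folklore] -/
theorem transversal_frame {x : 𝔼 2} (hx : x ∈ ball (0 : 𝔼 2) 1) (v a : 𝔼 2)
    (h : fderiv ℝ g x v + ∑ i, a i • S.frame i x = 0) : v = 0 ∧ a = 0 := by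
  have hxR : x ∈ ball (0 : 𝔼 2) S.R' := S.ball_subset hx
  have hL : Injective (fderiv ℝ g x) := S.injective_fderiv x hxR
  by_cases h1 : ‖x‖ ≤ S.γ₁
  · -- the deep frame
    refine S.transversal_n hx (h1.trans (S.γ₁_lt_γ₂.trans S.γ₂_lt_t₀).le) v a ?_
    simpa only [S.frame_of_le _ h1] using h
  by_cases h2 : ‖x‖ ≤ S.t₀
  · -- the blend zone: openness of transversality
    have h4 := S.indep_blend x (not_le.1 h1).le h2 (S.φ x) (S.φ_mem x)
    exact (transversal_iff_linearIndependent_four (fun i ↦ S.frame i x)).2 h4 v a h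
  · -- the closed band: the framing is the cone field, with normal projection the boundary frame
    have hxt : S.t₀ ≤ ‖x‖ := (not_le.1 h2).le
    have hx1 : ‖x‖ < 1 := mem_ball_zero_iff.1 hx
    set u : 𝕊 1 := radialProjection (spherePt 1) x with hu
    have hxu : x = ‖x‖ • (u : 𝔼 2) := eq_norm_smul_radialProjection x
    have hframe : ∀ i, S.frame i x = S.cx i x := fun i ↦ S.frame_of_ge i (S.γ₂_lt_t₀.le.trans hxt)
    refine (transversal_iff_linearIndependent_normProj hL (fun i ↦ S.frame i x)).2 ?_ v a h
    have hproj : (fun i ↦ normProj (fderiv ℝ g x) (S.frame i x)) = fun i ↦ ‖x‖ • S.F i (S.r₀ • (u : 𝔼 2)) := by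
      funext i
      rw [hframe, ← S.P_apply]
      conv_lhs => rw [hxu]
      exact S.P_cx i u hxt hx1
    rw [hproj]
    have hF := S.linearIndependent_F _ (S.r₀_smul_mem_ball u)
    have hx0 : ‖x‖ ≠ 0 := by linarith [S.t₀_pos]
    rw [Fintype.linearIndependent_iff] at hF ⊢
    intro c hc
    have h' := hF (fun i ↦ c i * ‖x‖) (by simpa only [mul_smul, ← Finset.smul_sum] using hc)
    intro i
    exact (mul_eq_zero.1 (h' i)).resolve_right hx0

/-- **On the band `1 - s₂ < t < 1` the blended framing is the cone on the fibre derivative of `ν`.**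
[folklore] -/
theorem frame_cone (i : Fin 2) (u : 𝕊 1) {t : ℝ} (ht : 1 - S.s₂ < t) :
    S.frame i (t • (u : 𝔼 2)) =
      t • fderiv ℝ (fun w : 𝔼 2 ↦ ((S.ν (u, w) : 𝕊 3) : 𝔼 4)) 0 (EuclideanSpace.single i 1) := by
  have hγt : S.γ₂ < t := by unfold s₂ at ht; linarith
  have htpos : 0 < t := (S.γ₁_pos.trans S.γ₁_lt_γ₂).trans hγt
  rw [S.frame_of_ge i (by rw [norm_smul_coe_sphere htpos.le]; exact hγt.le), S.cx_smul_coe i htpos u]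
  rfl

/-- **The conical transversal framing of the conical slice disc** (the datum of
`SliceDiscConicalTube.lean`). [folklore] -/
def conicalFraming : ConicalFraming K where
  g := g
  s₁ := s₁
  s₂ := S.s₂
  ν := S.ν
  n := S.frame
  isSliceDisc := S.isSliceDisc
  s₁_pos := S.s₁_pos
  s₁_lt_s₂ := S.s₁_lt_s₂
  s₂_lt_one := S.s₂_lt_one
  g_cone := S.g_cone
  contDiffOn_n := S.contDiffOn_frame
  transversal _ hx v a h := S.transversal_frame hx v a h
  n_cone i u _ ht _ := S.frame_cone i u ht

/-- The framing datum has the prescribed disc. [folklore] -/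
@[simp] theorem conicalFraming_g : S.conicalFraming.g = g := rfl

/-- The framing datum has the prescribed band width. [folklore] -/
@[simp] theorem conicalFraming_s₁ : S.conicalFraming.s₁ = s₁ := rfl

end FramingSetup₄

/-! ### Conclusion -/

/-- **Every conical slice disc has a conical transversal framing** with the prescribed band width:
a `ConicalFraming K` datum with `D.g = g`, `D.s₁ = s₁` (neat tubular neighbourhoods of neat
submanifolds, Kosinski (1993), Ch. III (4.1)–(4.2), for the disc in the ball, in trivialised form).
[cite: Kosinski1993, Ch. III Thm (4.2)] -/
theorem IsSliceDisc.exists_conicalFraming {K : Knot} {g : 𝔼 2 → 𝔼 4} {s₁ : ℝ} (hg : K.IsSliceDisc g)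
    (hs₁ : 0 < s₁) (hs₁' : s₁ < 1)
    (hcone : ∀ (u : 𝕊 1) (t : ℝ), 1 - s₁ ≤ t → t ≤ 1 → g (t • (u : 𝔼 2)) = t • ((K u : 𝕊 3) : 𝔼 4)) :
    ∃ D : ConicalFraming K, D.g = g ∧ D.s₁ = s₁ := by
  obtain ⟨S₁⟩ := nonempty_framingSetup hg hs₁ hs₁' hcone
  obtain ⟨S₂⟩ := S₁.nonempty_framingSetup₂
  obtain ⟨S₃⟩ := S₂.nonempty_framingSetup₃
  obtain ⟨S₄⟩ := S₃.nonempty_framingSetup₄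
  exact ⟨S₄.conicalFraming, rfl, rfl⟩

/-- **Discharge of the named fact `Knot.IsSliceDisc.exists_conicalTube_hasFraming_zero`** (the framed
conical tube of a conical slice disc: Kosinski (1993), Ch. III (4.1)–(4.2) for the neat tube, Kirby
(1989), Ch. I §2, p. 6 for the zero framing): the conical framing (`exists_conicalFraming`), the tube
built from it (`SliceDiscConicalTube.lean`) and its framing (`SliceDiscConicalTubeFraming.lean`).
[cite: Kosinski1993, Ch. III Thm (4.2)] -/
theorem IsSliceDisc.exists_conicalTube_hasFraming_zero_holds : IsSliceDisc.exists_conicalTube_hasFraming_zero := by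
  intro K g₁ s₁ hg hs₁ hs₁' hcone
  obtain ⟨D, rfl, rfl⟩ := hg.exists_conicalFraming hs₁ hs₁' hcone
  exact D.exists_conicalTube_hasFraming_zero

end Knot

end Literature.Topology.FourManifolds
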